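import Summits.MatrixMultiplication.OmegaCensus.STPPVosperSlackOneCoverStepsWd
import Summits.MatrixMultiplication.OmegaCensus.STPPVosperTilingWordsEnumExtract

/-!
# ω-census (abelian STPP census): steps for the slack-1 `a = 2` cover law over a general block enumerator — the α₂ test and duplicate-freeness (kernel)

HONEST FRAMING (pub-omega census; verbatim): lottery ticket; floor = certified bounds/negative ranges.
Census STRUCTURE (seat pub-omega-stpp-1 gen 32, 2026-08-28), family (b2).  Helpers for `no_isSTPP_of_slack_one_coverE_prime_a2`
(`STPPVosperSlackOneCoverLawA2E.lean`): the α₂ cover test `coverA2E` (as stpp-2's `coverA2W`, through `existsCoverW` over a block enumerator `bd`), the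
identification `map_sizes_bd` of candidate lists indexed by size triples with those indexed by blocks, and the duplicate-freeness of the value lists fed to
`existsCoverW_both_of_isSTPP_enum` (`nodup_range_map_mul_val`, `nodup_range_map_affine_val`, `nodup_range_append_singleton`, `nodup_twoRunVals_of_disjoint`).
Nothing here is progress on `ω`.

References: H. Cohn, R. Kleinberg, B. Szegedy, C. Umans, FOCS 2005 (arXiv:math/0511460), Def. 5.1.
-/

open Finset
open scoped Pointwise

namespace Summit.MatrixMultiplication.OmegaCensus.CubeNB

open Literature.Computability.AlgebraicComplexity
open Literature.Combinatorics.Additive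
open Summit.MatrixMultiplication.OmegaCensus.STPPKneser

/-! ## §0 The α₂ cover test over an enumerator; duplicate-freeness of the value lists -/

section Helpers

variable {p : ℕ} [hp : Fact p.Prime]

/-- The cover test WITH WORDS of an α₂ row-shape `(j, ℓ₁, δ)` through `existsCoverW` over the block enumerator `bd`, Z-first (`zfirst = true`) or Y-first.
[folklore] -/
def coverA2E (bd : List ℕ → List ℕ → ℕ → ℕ → ℕ → List (List ℕ × List ℕ × List ℕ)) (p L z : ℕ) (sAB sBA : List (ℕ × ℕ × ℕ)) (zfirst : Bool)
    (j ℓ₁ δ : ℕ) : Bool :=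
  if zfirst then
    existsCoverW p (List.range z) (twoRunVals p j ℓ₁ δ L) (sBA.map fun s => bd (List.range z) (twoRunVals p j ℓ₁ δ L) s.1 s.2.1 s.2.2) [] [] []
  else
    existsCoverW p (twoRunVals p j ℓ₁ δ L) (List.range z) (sAB.map fun s => bd (twoRunVals p j ℓ₁ δ L) (List.range z) s.1 s.2.1 s.2.2) [] [] []

/-- `[(t₀ + t•j).val : t < L]` is duplicate-free for `j ≠ 0` and `L ≤ p`. [folklore] -/
theorem nodup_range_map_affine_val (t₀ j : ZMod p) (hj : j ≠ 0) {L : ℕ} (hL : L ≤ p) :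
    ((List.range L).map fun t => (t₀.val + j.val * t) % p).Nodup := by
  refine List.Nodup.map_on ?_ List.nodup_range
  intro t ht t' ht' h
  rw [List.mem_range] at ht ht'
  refine zmod_natMul_injOn (t := t₀) hj (by omega) (by omega) ?_
  apply ZMod.val_injective p
  rw [val_add_nsmul_zmod, val_add_nsmul_zmod]
  exact h

/-- `[(t•j).val : t < L]` is duplicate-free for `j ≠ 0` and `L ≤ p`. [folklore] -/
theorem nodup_range_map_mul_val (j : ZMod p) (hj : j ≠ 0) {L : ℕ} (hL : L ≤ p) :
    ((List.range L).map fun t => (j.val * t) % p).Nodup := by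
  have h := nodup_range_map_affine_val 0 j hj hL
  simp only [ZMod.val_zero, zero_add] at h
  exact h

/-- `[0, …, z−1, k]` is duplicate-free for `k ≥ z`. [folklore] -/
theorem nodup_range_append_singleton {z k : ℕ} (hk : z ≤ k) : (List.range z ++ [k]).Nodup := by
  rw [List.nodup_append]
  refine ⟨List.nodup_range, List.nodup_singleton k, ?_⟩
  intro a ha b hb
  rw [List.mem_range] at ha
  rw [List.mem_singleton] at hb
  omega

/-- The value list of two DISJOINT `s`-runs (`twoRunVals` with `j = (u s).val`, `δ = (u (c₂ − c₁)).val`, `u ≠ 0`) is duplicate-free. [folklore] -/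
theorem nodup_twoRunVals_of_disjoint {u c₁ c₂ s : ZMod p} (hu : u ≠ 0) (hs : s ≠ 0) {ℓ₁ ℓ₂ L : ℕ} (hL : ℓ₁ + ℓ₂ = L) (hLp : L ≤ p)
    (hdisj : Disjoint (apFinset c₁ s ℓ₁) (apFinset c₂ s ℓ₂)) :
    (twoRunVals p (u * s).val ℓ₁ (u * (c₂ - c₁)).val L).Nodup := by
  have hj : u * s ≠ 0 := mul_ne_zero hu hs
  rw [twoRunVals, List.nodup_append]
  refine ⟨nodup_range_map_mul_val (u * s) hj (by omega), nodup_range_map_affine_val (u * (c₂ - c₁)) (u * s) hj (by omega), ?_⟩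
  have key : ∀ t < ℓ₁, ∀ t' < L - ℓ₁, ((u * s).val * t) % p ≠ ((u * (c₂ - c₁)).val + (u * s).val * t') % p := by
    intro t ht t' ht' h
    have h1 : ((0 : ZMod p) + t • (u * s)).val = (u * (c₂ - c₁) + t' • (u * s)).val := by
      rw [val_add_nsmul_zmod, val_add_nsmul_zmod, ZMod.val_zero, zero_add]; exact h
    have h2 : (0 : ZMod p) + t • (u * s) = u * (c₂ - c₁) + t' • (u * s) := ZMod.val_injective p h1
    have h3 : c₁ + t • s = c₂ + t' • s := by
      have h4 : u * (c₁ + t • s) = u * (c₂ + t' • s) := by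
        rw [nsmul_eq_mul, nsmul_eq_mul] at h2 ⊢; linear_combination h2
      exact mul_left_cancel₀ hu h4
    have hm1 : c₁ + t • s ∈ apFinset c₁ s ℓ₁ := mem_apFinset.2 ⟨t, ht, rfl⟩
    have hm2 : c₁ + t • s ∈ apFinset c₂ s ℓ₂ := by rw [h3]; exact mem_apFinset.2 ⟨t', by omega, rfl⟩
    exact Finset.disjoint_left.1 hdisj hm1 hm2
  intro a ha b hb
  obtain ⟨t, ht, rfl⟩ := List.mem_map.1 ha
  obtain ⟨t', ht', rfl⟩ := List.mem_map.1 hb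
  rw [List.mem_range] at ht ht'
  exact key t ht t' ht'

omit hp in
/-- Candidate lists indexed by the size triples of the blocks are the candidate lists indexed by the blocks. [folklore] -/
theorem map_sizes_bd {N : ℕ} (A B C : Fin N → Finset (ZMod p)) (bd : List ℕ → List ℕ → ℕ → ℕ → ℕ → List (List ℕ × List ℕ × List ℕ))
    (YL ZL : List ℕ) (ks : List (Fin N)) :
    ((ks.map fun k => (#(A k), #(B k), #(C k))).map fun s => bd YL ZL s.1 s.2.1 s.2.2) = ks.map fun k => bd YL ZL #(A k) #(B k) #(C k) := by
  rw [List.map_map]; rfl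

end Helpers

end Summit.MatrixMultiplication.OmegaCensus.CubeNB
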